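import Literature.NumberTheory.PAdicHodge.DeRhamBlockSumSizes
import HarnessLib

/-!
# Sub- and quotient representations of a de Rham representation are de Rham
# (block upper-triangular framed form; Fontaine, Astérisque 223, Exp. III Prop. 1.5.2)

Topic `NumberTheory/PAdicHodge`.  PROOF FILE (theorems only: no definition, no named fact, no
instance; D-0026).  For continuous framed `ρ : Γ_F → GL_{m+n}(ℚ̄_ℓ)` of block upper-triangular shape

  `ρ(g) = ( ρ₁(g)  X(g) ; 0  ρ₂(g) )`   (reindexed along `finSumFinEquiv`),

with `ρ₁ : Γ_F → GL_m(ℚ̄_ℓ)` (the subrepresentation on the first `m` coordinates) and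
`ρ₂ : Γ_F → GL_n(ℚ̄_ℓ)` (the quotient): if `ρ` is de Rham then so are `ρ₁` and `ρ₂`
(`FramedRep.IsDeRhamWith.of_blockTriangular`).  The converse is false in general (non-de Rham
extensions of de Rham representations), so only this direction is stated.

Proof.  Descend the frame of a finite model of `ρ` to a finite `E' ⊆ ℚ̄_ℓ`
(`exists_conj_baseChange_eq_of_hasQlModel`): the model `TE` has the SAME matrices with entries in
`E'`, so it is block upper-triangular over `E'` with diagonal blocks the `E'`-models `BE₁`, `BE₂` of
`ρ₁`, `ρ₂` (`FramedRep.exists_baseChange_eq`).  Extension by zero `E'^m → E'^{m+n}` and projection to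
the last `n` coordinates form a short exact sequence of `ℚ_ℓ[Γ_F]`-modules
`0 → BE₁ → TE → BE₂ → 0`, and the accepted `PeriodRingData.isAdmissible_of_shortExact` (Fontaine,
Exp. III Prop. 1.5.2: sub-objects and quotients of admissible objects are admissible) concludes.
Also the `PstWeilDeligneData` form and, for a number field and THE pinned Fontaine data,
`isDeRhamFramed_toLocal_of_blockTriangular`.

## References

* [FontaineAsterisque223III] J.-M. Fontaine, *Représentations p-adiques semi-stables*, Astérisque
  223 (1994), Exp. III §1.5, Prop. 1.5.2.
* [BrinonConrad2009] O. Brinon, B. Conrad, *CMI Summer School notes on p-adic Hodge theory*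
  (2009), Thm. 5.2.1 (sub-quotient stability of `B`-admissible representations).
* [BuzzardGeeLMS2014] K. Buzzard, T. Gee, *The conjectural connections between automorphic
  representations and Galois representations* (2014), §2.2 (finite coefficient fields).
-/

noncomputable section

open scoped NumberField TensorProduct
open Field Literature.NumberTheory.GaloisRepresentations

namespace Literature.NumberTheory.GaloisRepresentations

open Literature.NumberTheory.PAdicHodge

section DeRham

variable {F : Type} [Field F] {ℓ : ℕ} [Fact ℓ.Prime]

-- Mathlib's own global value (nested instance problems on `𝔅.B ⊗[P] M`, see `PAdicHodgeProofs`).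
set_option maxHeartbeats 400000 in
set_option maxSynthPendingDepth 3 in
/-- **Sub- and quotient representations of a de Rham representation are de Rham** (block
upper-triangular framed form, any period-ring datum, accepted `FramedRep.IsDeRhamWith`): if
`ρ(g) = reindex (fromBlocks ρ₁(g) X(g) 0 ρ₂(g))` for all `g` and `ρ` is de Rham, then `ρ₁` and `ρ₂`
are de Rham.  Model descent to a finite `E'` + the short exact sequence
`0 → E'^m → E'^{m+n} → E'^n → 0` of `ℚ_ℓ[Γ_F]`-modules + `PeriodRingData.isAdmissible_of_shortExact`.
[cite: FontaineAsterisque223III, Exp. III §1.5, Prop. 1.5.2] [cite: BrinonConrad2009, Thm. 5.2.1]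
[cite: BuzzardGeeLMS2014, §2.2] -/
theorem FramedRep.IsDeRhamWith.of_blockTriangular (alg : Algebra ℚ_[ℓ] F)
    (𝔅 : PeriodRingData.{0, 0, 0, 0} (absoluteGaloisGroup F) ℚ_[ℓ] F) {m n : ℕ}
    {ρ : FramedRep (absoluteGaloisGroup F) (PadicAlgCl ℓ) (m + n)}
    {ρ₁ : FramedRep (absoluteGaloisGroup F) (PadicAlgCl ℓ) m}
    {ρ₂ : FramedRep (absoluteGaloisGroup F) (PadicAlgCl ℓ) n}
    (X : absoluteGaloisGroup F → Matrix (Fin m) (Fin n) (PadicAlgCl ℓ))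
    (hρ : ∀ g, ((ρ g : GL (Fin (m + n)) (PadicAlgCl ℓ)) : Matrix (Fin (m + n)) (Fin (m + n)) (PadicAlgCl ℓ))
      = Matrix.reindex finSumFinEquiv finSumFinEquiv
          (Matrix.fromBlocks ((ρ₁ g : GL (Fin m) (PadicAlgCl ℓ)) : Matrix (Fin m) (Fin m) (PadicAlgCl ℓ))
            (X g) 0 ((ρ₂ g : GL (Fin n) (PadicAlgCl ℓ)) : Matrix (Fin n) (Fin n) (PadicAlgCl ℓ))))
    (h : ρ.IsDeRhamWith alg 𝔅) : ρ₁.IsDeRhamWith alg 𝔅 ∧ ρ₂.IsDeRhamWith alg 𝔅 := by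
  letI := alg
  classical
  obtain ⟨E, hE, rE, hmodel, hadm⟩ := h
  haveI := hE
  obtain ⟨E', hEE', hE', Q, hTQ⟩ := exists_conj_baseChange_eq_of_hasQlModel hmodel
  haveI := hE'
  -- the descended model `TE` of `ρ` over `E'`
  set TE : FramedRep (absoluteGaloisGroup F) E' (m + n) := FramedRep.conj Q
    (rE.baseChange (IntermediateField.inclusion hEE').toRingHom
      (continuous_intermediateField_inclusion hEE')) with hTEdef
  have hadmTE : 𝔅.IsAdmissible (FramedRep.restrictScalars ℚ_[ℓ] TE) := by
    rw [hTEdef, 𝔅.isAdmissible_restrictScalars_conj_iff,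
      𝔅.isAdmissible_restrictScalars_baseChange_iff]
    exact hadm
  -- entries: `algebraMap (TE g a b) = ρ g a b`
  have hTEentry : ∀ g a b, algebraMap E' (PadicAlgCl ℓ)
      (((TE g : GL (Fin (m + n)) E') : Matrix (Fin (m + n)) (Fin (m + n)) E') a b) =
        ((ρ g : GL (Fin (m + n)) (PadicAlgCl ℓ)) : Matrix (Fin (m + n)) (Fin (m + n)) (PadicAlgCl ℓ)) a b :=
    fun g a b => by rw [← hTQ, FramedRep.coe_baseChange_apply, Matrix.map_apply]
  have hTmem : ∀ g a b, ((ρ g : GL (Fin (m + n)) (PadicAlgCl ℓ)) :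
      Matrix (Fin (m + n)) (Fin (m + n)) (PadicAlgCl ℓ)) a b ∈ E' := fun g a b => by
    rw [← hTEentry]
    exact SetLike.coe_mem _
  -- the diagonal blocks of `ρ`
  have h₁T : ∀ g k l, ((ρ₁ g : GL (Fin m) (PadicAlgCl ℓ)) : Matrix (Fin m) (Fin m) (PadicAlgCl ℓ)) k l
      = ((ρ g : GL (Fin (m + n)) (PadicAlgCl ℓ)) :
          Matrix (Fin (m + n)) (Fin (m + n)) (PadicAlgCl ℓ)) (Fin.castAdd n k) (Fin.castAdd n l) :=
    fun g k l => by
      rw [hρ g, Matrix.reindex_apply, Matrix.submatrix_apply, finSumFinEquiv_symm_apply_castAdd,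
        finSumFinEquiv_symm_apply_castAdd, Matrix.fromBlocks_apply₁₁]
  have h₂T : ∀ g k l, ((ρ₂ g : GL (Fin n) (PadicAlgCl ℓ)) : Matrix (Fin n) (Fin n) (PadicAlgCl ℓ)) k l
      = ((ρ g : GL (Fin (m + n)) (PadicAlgCl ℓ)) :
          Matrix (Fin (m + n)) (Fin (m + n)) (PadicAlgCl ℓ)) (Fin.natAdd m k) (Fin.natAdd m l) :=
    fun g k l => by
      rw [hρ g, Matrix.reindex_apply, Matrix.submatrix_apply, finSumFinEquiv_symm_apply_natAdd,
        finSumFinEquiv_symm_apply_natAdd, Matrix.fromBlocks_apply₂₂]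
  have h₂₁T : ∀ g k l, ((ρ g : GL (Fin (m + n)) (PadicAlgCl ℓ)) :
      Matrix (Fin (m + n)) (Fin (m + n)) (PadicAlgCl ℓ)) (Fin.natAdd m k) (Fin.castAdd n l) = 0 :=
    fun g k l => by
      rw [hρ g, Matrix.reindex_apply, Matrix.submatrix_apply, finSumFinEquiv_symm_apply_natAdd,
        finSumFinEquiv_symm_apply_castAdd, Matrix.fromBlocks_apply₂₁, Matrix.zero_apply]
  have h₁mem : ∀ g k l, ((ρ₁ g : GL (Fin m) (PadicAlgCl ℓ)) :
      Matrix (Fin m) (Fin m) (PadicAlgCl ℓ)) k l ∈ E' ∧ (((ρ₁ g)⁻¹ : GL (Fin m) (PadicAlgCl ℓ)) :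
        Matrix (Fin m) (Fin m) (PadicAlgCl ℓ)) k l ∈ E' := fun g k l =>
    ⟨by rw [h₁T]; exact hTmem g _ _, by rw [← map_inv, h₁T]; exact hTmem g⁻¹ _ _⟩
  have h₂mem : ∀ g k l, ((ρ₂ g : GL (Fin n) (PadicAlgCl ℓ)) :
      Matrix (Fin n) (Fin n) (PadicAlgCl ℓ)) k l ∈ E' ∧ (((ρ₂ g)⁻¹ : GL (Fin n) (PadicAlgCl ℓ)) :
        Matrix (Fin n) (Fin n) (PadicAlgCl ℓ)) k l ∈ E' := fun g k l =>
    ⟨by rw [h₂T]; exact hTmem g _ _, by rw [← map_inv, h₂T]; exact hTmem g⁻¹ _ _⟩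
  obtain ⟨BE₁, hBE₁⟩ := FramedRep.exists_baseChange_eq ρ₁ E' h₁mem
  obtain ⟨BE₂, hBE₂⟩ := FramedRep.exists_baseChange_eq ρ₂ E' h₂mem
  have hBE₁entry : ∀ g k l, algebraMap E' (PadicAlgCl ℓ)
      (((BE₁ g : GL (Fin m) E') : Matrix (Fin m) (Fin m) E') k l) =
        ((ρ₁ g : GL (Fin m) (PadicAlgCl ℓ)) : Matrix (Fin m) (Fin m) (PadicAlgCl ℓ)) k l :=
    fun g k l => by rw [← hBE₁, FramedRep.coe_baseChange_apply, Matrix.map_apply]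
  have hBE₂entry : ∀ g k l, algebraMap E' (PadicAlgCl ℓ)
      (((BE₂ g : GL (Fin n) E') : Matrix (Fin n) (Fin n) E') k l) =
        ((ρ₂ g : GL (Fin n) (PadicAlgCl ℓ)) : Matrix (Fin n) (Fin n) (PadicAlgCl ℓ)) k l :=
    fun g k l => by rw [← hBE₂, FramedRep.coe_baseChange_apply, Matrix.map_apply]
  -- the block structure of `TE` over `E'` (injectivity of `E' → ℚ̄_ℓ`)
  have hinjE : Function.Injective (algebraMap E' (PadicAlgCl ℓ)) :=
    (algebraMap E' (PadicAlgCl ℓ)).injective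
  have hTE₁₁ : ∀ g k l, (((TE g : GL (Fin (m + n)) E') : Matrix (Fin (m + n)) (Fin (m + n)) E')
      (Fin.castAdd n k) (Fin.castAdd n l)) = ((BE₁ g : GL (Fin m) E') : Matrix (Fin m) (Fin m) E') k l :=
    fun g k l => hinjE (by rw [hTEentry, hBE₁entry, h₁T])
  have hTE₂₂ : ∀ g k l, (((TE g : GL (Fin (m + n)) E') : Matrix (Fin (m + n)) (Fin (m + n)) E')
      (Fin.natAdd m k) (Fin.natAdd m l)) = ((BE₂ g : GL (Fin n) E') : Matrix (Fin n) (Fin n) E') k l :=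
    fun g k l => hinjE (by rw [hTEentry, hBE₂entry, h₂T])
  have hTE₂₁ : ∀ g k l, (((TE g : GL (Fin (m + n)) E') : Matrix (Fin (m + n)) (Fin (m + n)) E')
      (Fin.natAdd m k) (Fin.castAdd n l)) = 0 :=
    fun g k l => hinjE (by rw [hTEentry, map_zero, h₂₁T])
  -- the short exact sequence `0 → E'^m → E'^{m+n} → E'^n → 0` of `ℚ_ℓ[Γ_F]`-modules
  let f : (Fin m → E') →ₗ[ℚ_[ℓ]] (Fin (m + n) → E') :=
    { toFun := fun x j => Sum.elim x (0 : Fin n → E') (finSumFinEquiv.symm j)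
      map_add' := fun x y => by
        funext j
        simp only [Pi.add_apply]
        cases finSumFinEquiv.symm j <;> simp
      map_smul' := fun c x => by
        funext j
        simp only [Pi.smul_apply, RingHom.id_apply]
        cases finSumFinEquiv.symm j <;> simp }
  have hfapp : ∀ (x : Fin m → E') (j : Fin (m + n)), f x j = Sum.elim x (0 : Fin n → E') (finSumFinEquiv.symm j) :=
    fun x j => rfl
  let g : (Fin (m + n) → E') →ₗ[ℚ_[ℓ]] (Fin n → E') := LinearMap.funLeft ℚ_[ℓ] E' (Fin.natAdd m)
  have hgapp : ∀ (v : Fin (m + n) → E') (i : Fin n), g v i = v (Fin.natAdd m i) := fun v i => rfl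
  -- `TE g · v` in coordinates
  have hmulVec_castAdd : ∀ (σ : absoluteGaloisGroup F) (x : Fin m → E') (k : Fin m),
      (Matrix.mulVec ((TE σ : GL (Fin (m + n)) E') : Matrix (Fin (m + n)) (Fin (m + n)) E') (f x)) (Fin.castAdd n k) =
        (Matrix.mulVec ((BE₁ σ : GL (Fin m) E') : Matrix (Fin m) (Fin m) E') x) k := by
    intro σ x k
    simp only [Matrix.mulVec, dotProduct, Fin.sum_univ_add, hfapp, finSumFinEquiv_symm_apply_castAdd,
      finSumFinEquiv_symm_apply_natAdd, Sum.elim_inl, Sum.elim_inr, Pi.zero_apply, mul_zero,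
      Finset.sum_const_zero, add_zero, hTE₁₁]
  have hmulVec_natAdd_f : ∀ (σ : absoluteGaloisGroup F) (x : Fin m → E') (k : Fin n),
      (Matrix.mulVec ((TE σ : GL (Fin (m + n)) E') : Matrix (Fin (m + n)) (Fin (m + n)) E') (f x)) (Fin.natAdd m k) = 0 := by
    intro σ x k
    simp only [Matrix.mulVec, dotProduct, Fin.sum_univ_add, hfapp, finSumFinEquiv_symm_apply_castAdd,
      finSumFinEquiv_symm_apply_natAdd, Sum.elim_inl, Sum.elim_inr, Pi.zero_apply, mul_zero,
      Finset.sum_const_zero, add_zero, hTE₂₁, zero_mul]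
  have hmulVec_natAdd : ∀ (σ : absoluteGaloisGroup F) (v : Fin (m + n) → E') (k : Fin n),
      (Matrix.mulVec ((TE σ : GL (Fin (m + n)) E') : Matrix (Fin (m + n)) (Fin (m + n)) E') v) (Fin.natAdd m k) =
        (Matrix.mulVec ((BE₂ σ : GL (Fin n) E') : Matrix (Fin n) (Fin n) E') (g v)) k := by
    intro σ v k
    simp only [Matrix.mulVec, dotProduct, Fin.sum_univ_add, hgapp, hTE₂₁, zero_mul,
      Finset.sum_const_zero, zero_add, hTE₂₂]
  have hf : ∀ (σ : absoluteGaloisGroup F) (x : Fin m → E'),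
      f (FramedRep.restrictScalars ℚ_[ℓ] BE₁ σ x) = FramedRep.restrictScalars ℚ_[ℓ] TE σ (f x) := by
    intro σ x
    rw [FramedRep.restrictScalars_apply_apply, FramedRep.restrictScalars_apply_apply]
    funext j
    obtain ⟨s, rfl⟩ := finSumFinEquiv.surjective j
    rcases s with k | k
    · rw [finSumFinEquiv_apply_left, hmulVec_castAdd, hfapp, finSumFinEquiv_symm_apply_castAdd,
        Sum.elim_inl]
    · rw [finSumFinEquiv_apply_right, hmulVec_natAdd_f, hfapp, finSumFinEquiv_symm_apply_natAdd,
        Sum.elim_inr, Pi.zero_apply]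
  have hg : ∀ (σ : absoluteGaloisGroup F) (v : Fin (m + n) → E'),
      g (FramedRep.restrictScalars ℚ_[ℓ] TE σ v) = FramedRep.restrictScalars ℚ_[ℓ] BE₂ σ (g v) := by
    intro σ v
    rw [FramedRep.restrictScalars_apply_apply, FramedRep.restrictScalars_apply_apply]
    funext k
    rw [hgapp, hmulVec_natAdd]
  have hfinj : Function.Injective f := by
    refine Function.LeftInverse.injective (g := fun v k => v (Fin.castAdd n k)) fun x => ?_
    funext k
    rw [hfapp, finSumFinEquiv_symm_apply_castAdd, Sum.elim_inl]
  have hgsurj : Function.Surjective g := by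
    intro u
    refine ⟨fun j => Sum.elim (0 : Fin m → E') u (finSumFinEquiv.symm j), ?_⟩
    funext k
    rw [hgapp, finSumFinEquiv_symm_apply_natAdd, Sum.elim_inr]
  have hex : Function.Exact f g := by
    intro v
    constructor
    · intro hv
      refine ⟨fun k => v (Fin.castAdd n k), ?_⟩
      funext j
      obtain ⟨s, rfl⟩ := finSumFinEquiv.surjective j
      rcases s with k | k
      · rw [finSumFinEquiv_apply_left, hfapp, finSumFinEquiv_symm_apply_castAdd, Sum.elim_inl]
      · rw [finSumFinEquiv_apply_right, hfapp, finSumFinEquiv_symm_apply_natAdd, Sum.elim_inr,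
          Pi.zero_apply]
        have := congr_fun hv k
        rw [hgapp] at this
        exact this.symm
    · rintro ⟨x, rfl⟩
      funext k
      rw [hgapp, hfapp, finSumFinEquiv_symm_apply_natAdd, Sum.elim_inr]
  have hadm₁₂ := 𝔅.isAdmissible_of_shortExact (FramedRep.restrictScalars ℚ_[ℓ] BE₁)
    (FramedRep.restrictScalars ℚ_[ℓ] TE) (FramedRep.restrictScalars ℚ_[ℓ] BE₂) f g hf hg hfinj hgsurj
    hex hadmTE
  exact ⟨⟨E', hE', BE₁, ⟨1, by rw [hBE₁, FramedRep.conj_one_eq]⟩, hadm₁₂.1⟩,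
    ⟨E', hE', BE₂, ⟨1, by rw [hBE₂, FramedRep.conj_one_eq]⟩, hadm₁₂.2⟩⟩

/-- **Sub- and quotient representations of a de Rham representation are de Rham, for a `p`-adic
Hodge datum** (accepted `PstWeilDeligneData.IsDeRhamFramed`; block upper-triangular framed form).
[cite: FontaineAsterisque223III, Exp. III §1.5, Prop. 1.5.2] -/
theorem PstWeilDeligneData.isDeRhamFramed_of_blockTriangular [ValuativeRel F] [TopologicalSpace F]
    [IsNonarchimedeanLocalField F] (𝔇 : PstWeilDeligneData F ℓ) {m n : ℕ}
    {ρ : FramedRep (absoluteGaloisGroup F) (PadicAlgCl ℓ) (m + n)}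
    {ρ₁ : FramedRep (absoluteGaloisGroup F) (PadicAlgCl ℓ) m}
    {ρ₂ : FramedRep (absoluteGaloisGroup F) (PadicAlgCl ℓ) n}
    (X : absoluteGaloisGroup F → Matrix (Fin m) (Fin n) (PadicAlgCl ℓ))
    (hρ : ∀ g, ((ρ g : GL (Fin (m + n)) (PadicAlgCl ℓ)) : Matrix (Fin (m + n)) (Fin (m + n)) (PadicAlgCl ℓ))
      = Matrix.reindex finSumFinEquiv finSumFinEquiv
          (Matrix.fromBlocks ((ρ₁ g : GL (Fin m) (PadicAlgCl ℓ)) : Matrix (Fin m) (Fin m) (PadicAlgCl ℓ))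
            (X g) 0 ((ρ₂ g : GL (Fin n) (PadicAlgCl ℓ)) : Matrix (Fin n) (Fin n) (PadicAlgCl ℓ))))
    (h : 𝔇.IsDeRhamFramed ρ) : 𝔇.IsDeRhamFramed ρ₁ ∧ 𝔇.IsDeRhamFramed ρ₂ :=
  FramedRep.IsDeRhamWith.of_blockTriangular 𝔇.algebra 𝔇.𝔅 X hρ h

end DeRham

end Literature.NumberTheory.GaloisRepresentations

namespace Literature.NumberTheory.PAdicHodge

section Pinned

open NumberField IsDedekindDomain

variable {K : Type} [Field K] [NumberField K] {ℓ : ℕ} [Fact ℓ.Prime]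

/-- **For THE pinned Fontaine data of a number field `K`: if a global `ρ : Γ_K → GL_{m+n}(ℚ̄_ℓ)` is
block upper-triangular with diagonal blocks `ρ₁`, `ρ₂` and `ρ` is de Rham at `v ∣ ℓ`, then `ρ₁` and
`ρ₂` are de Rham at `v`** (`FramedGaloisRep.toLocal_apply`,
`PstWeilDeligneData.isDeRhamFramed_of_blockTriangular`).
[cite: FontaineAsterisque223III, Exp. III §1.5, Prop. 1.5.2] -/
theorem isDeRhamFramed_toLocal_of_blockTriangular {m n : ℕ}
    {ρ : FramedGaloisRep K (PadicAlgCl ℓ) (m + n)} {ρ₁ : FramedGaloisRep K (PadicAlgCl ℓ) m}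
    {ρ₂ : FramedGaloisRep K (PadicAlgCl ℓ) n}
    (X : absoluteGaloisGroup K → Matrix (Fin m) (Fin n) (PadicAlgCl ℓ))
    (hρ : ∀ g, ((ρ g : GL (Fin (m + n)) (PadicAlgCl ℓ)) : Matrix (Fin (m + n)) (Fin (m + n)) (PadicAlgCl ℓ))
      = Matrix.reindex finSumFinEquiv finSumFinEquiv
          (Matrix.fromBlocks ((ρ₁ g : GL (Fin m) (PadicAlgCl ℓ)) : Matrix (Fin m) (Fin m) (PadicAlgCl ℓ))
            (X g) 0 ((ρ₂ g : GL (Fin n) (PadicAlgCl ℓ)) : Matrix (Fin n) (Fin n) (PadicAlgCl ℓ))))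
    (v : HeightOneSpectrum (𝓞 K)) (hv : ((ℓ : ℕ) : 𝓞 K) ∈ v.asIdeal)
    (h : (fontainePstAdicCompletion v ℓ hv).IsDeRhamFramed (ρ.toLocal v)) :
    (fontainePstAdicCompletion v ℓ hv).IsDeRhamFramed (ρ₁.toLocal v) ∧
      (fontainePstAdicCompletion v ℓ hv).IsDeRhamFramed (ρ₂.toLocal v) :=
  (fontainePstAdicCompletion v ℓ hv).isDeRhamFramed_of_blockTriangular
    (fun σ => X (absGaloisRestrict K (v.adicCompletion K) σ))
    (fun σ => by simp only [FramedGaloisRep.toLocal_apply]; exact hρ _) h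

/-- Hence: **if a block upper-triangular global `ρ` is de Rham at every place above `ℓ`, so are its
diagonal blocks `ρ₁` (sub) and `ρ₂` (quotient).** [cite: FontaineAsterisque223III, Exp. III §1.5, Prop. 1.5.2] -/
theorem forall_isDeRhamFramed_toLocal_of_blockTriangular {m n : ℕ}
    {ρ : FramedGaloisRep K (PadicAlgCl ℓ) (m + n)} {ρ₁ : FramedGaloisRep K (PadicAlgCl ℓ) m}
    {ρ₂ : FramedGaloisRep K (PadicAlgCl ℓ) n}
    (X : absoluteGaloisGroup K → Matrix (Fin m) (Fin n) (PadicAlgCl ℓ))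
    (hρ : ∀ g, ((ρ g : GL (Fin (m + n)) (PadicAlgCl ℓ)) : Matrix (Fin (m + n)) (Fin (m + n)) (PadicAlgCl ℓ))
      = Matrix.reindex finSumFinEquiv finSumFinEquiv
          (Matrix.fromBlocks ((ρ₁ g : GL (Fin m) (PadicAlgCl ℓ)) : Matrix (Fin m) (Fin m) (PadicAlgCl ℓ))
            (X g) 0 ((ρ₂ g : GL (Fin n) (PadicAlgCl ℓ)) : Matrix (Fin n) (Fin n) (PadicAlgCl ℓ))))
    (h : ∀ (v : HeightOneSpectrum (𝓞 K)) (hv : ((ℓ : ℕ) : 𝓞 K) ∈ v.asIdeal),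
      (fontainePstAdicCompletion v ℓ hv).IsDeRhamFramed (ρ.toLocal v)) :
    (∀ (v : HeightOneSpectrum (𝓞 K)) (hv : ((ℓ : ℕ) : 𝓞 K) ∈ v.asIdeal),
        (fontainePstAdicCompletion v ℓ hv).IsDeRhamFramed (ρ₁.toLocal v)) ∧
      ∀ (v : HeightOneSpectrum (𝓞 K)) (hv : ((ℓ : ℕ) : 𝓞 K) ∈ v.asIdeal),
        (fontainePstAdicCompletion v ℓ hv).IsDeRhamFramed (ρ₂.toLocal v) :=
  ⟨fun v hv => (isDeRhamFramed_toLocal_of_blockTriangular X hρ v hv (h v hv)).1,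
    fun v hv => (isDeRhamFramed_toLocal_of_blockTriangular X hρ v hv (h v hv)).2⟩

end Pinned

end Literature.NumberTheory.PAdicHodge

end
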